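import Summits.QuantumFields.YangMills.Theorems.BalabanLadderNTBoundaryLawCentred
import Summits.QuantumFields.YangMills.Theorems.LangevinControlUVOSLegsAtWeakCouplingCStubInheritTorus
import HarnessLib

/-!
# Crux `NT` (stmt-QuantumFields-19353): reference-state transfer, I — two-sided laws of total covariance /
# cumulance in OSCILLATION form, and the covariance transfer between DLR-consistent states

Helper file (`--supports stmt-QuantumFields-19353`) of the fleet lead prover of crux `NT` (unit `ym-spine-19353-p1`,
g4).  Kernel-checks, in the tree's vocabulary (`kerE`, `kerCov`, `torusE` of
`Theorems/LangevinControlUVOSLegsFromFemtoAndGapDefs.lean`), the transfer lemmas D1–D3′ of the crux idea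
`Cruxes/NT/Ideas/reference-state-transfer.md` (crux-ideate seat `ym-cruxidea-19353-1`, g3; its `Sketch.lean` §D proved
them with the radius-form law of total covariance `abs_cov_sub_integral_condCov_le`, constants `4hh'`/`8hh'`).  Here the
laws of total covariance and total CUMULANCE are proved TWO-SIDED and in OSCILLATION form (hypotheses
`|g ω − g ω'| ≤ h`, which is the format of the engine items E1/E2/E3-osc of the card), with the sharp constants
`h h'` and `h₁ w₂₃ + h₂ w₁₃ + h₃ w₁₂ + h₁ h₂ h₃`:

* §1 (abstract, compact probability spaces): `abs_sub_integral_le_of_osc`, `abs_integral_sub_integral_le_of_osc`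
  (two states average a function of oscillation `≤ ω` to within `ω`), `abs_cov_sub_integral_condCov_le_of_osc`,
  `abs_cum3_sub_integral_condCum3_le_of_osc`.
* §2 (cube kernels): for nested cubes `P ⊆ Q`, ONE exterior `η₀` of `Q` and bounded continuous `F, G'`,
  `|kerCov_Q^{η₀}(F,G') − kerE_Q^{η₀}[ζ ↦ kerCov_P^ζ(F,G')]| ≤ h h'` (`abs_kerCov_sub_kerE_kerCov_le`); for a torus of
  side `2L+1 ≥ b_P + 3` and cylinder `F, G'` windowed in `P`,
  `|torusCov_L(F,G') − torusE_L[kerCov_P^{lift ·}(F,G')]| ≤ h h'` (`abs_torusCov_sub_torusE_kerCov_le`); hence the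
  REFERENCE-STATE TRANSFER `|torusCov_L(F,G') − kerCov_Q^{η₀}(F,G')| ≤ 2 h h' + ω` for EVERY `L`
  (`abs_torusCov_sub_kerCov_le`, D3 two-sided), where `h, h'` bound the exterior-oscillation of the `P`-kernel
  means of `F, G'` and `ω` that of the `P`-kernel covariance (the torus–torus twin D3′ is in the sibling files).

Nothing here is an estimate on Yang–Mills: the inputs are DLR consistency (`BoundaryLaw.kerE_kerE_of_subset`, from
`isSpecification_ymSpecification_of_t2Space`) and the torus DLR step (`StubInherit.integral_lift_eq_integral_kerE_cube`).
The cumulant twin at the level of sites and the smearing bookkeeping `… ⇒ LowerBounds ⇒ NT` are the sibling files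
`…NTReferenceTransferCumulant.lean`, `…NTReferencePackage*.lean`.

Refs: Georgii 2011 Def. 1.23 (iii) / Thm. 4.17 (consistency, DLR kernels); Brillinger 1969 (law of total cumulance);
card `Cruxes/NT/Ideas/reference-state-transfer.md` §Mechanism 1–2, §First lemma D1–D3′.
-/

set_option autoImplicit false

noncomputable section

open MeasureTheory Filter Topology
open Literature.MathematicalPhysics.QuantumFieldTheory Literature.MathematicalPhysics.QuantumLattice
open Literature.Probability.LatticeModels
open Summit.QuantumFields.YangMills.Cruxes.OSLegsFromFemtoAndGap.DlrCollarTransfer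
open Summit.QuantumFields.YangMills.Cruxes.OSLegsFromFemtoAndGap.DlrCollarTransfer.StubLower (isCylinder_mul)
open Summit.QuantumFields.YangMills.Theorems.OSLegsFromFemtoAndGap.StubLower (integrable_of_continuous_compact)
open Summit.QuantumFields.YangMills.Cruxes.OSLegsAtWeakCouplingC.InheritedAmplitudeGates.StubInherit
  (integral_lift_eq_integral_kerE_cube)
open Summit.QuantumFields.YangMills.Cruxes.NT.BoundaryLaw (kerE_kerE_of_subset)

namespace Summit.QuantumFields.YangMills.Cruxes.NT.Reference

/-! ## §1 Oscillation-form laws of total covariance and cumulance on a compact probability space -/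

section Moments

variable {Ω : Type*} [TopologicalSpace Ω] [CompactSpace Ω] [MeasurableSpace Ω]
  [OpensMeasurableSpace Ω] {μ : Measure Ω} [IsProbabilityMeasure μ]

/-- A function of oscillation `≤ h` is within `h` of its mean. [folklore] -/
theorem abs_sub_integral_le_of_osc {g : Ω → ℝ} (hg : Continuous g) {h : ℝ}
    (hosc : ∀ ω ω', |g ω - g ω'| ≤ h) (ω : Ω) : |g ω - ∫ ω', g ω' ∂μ| ≤ h := by
  have i1 : Integrable g μ := integrable_of_continuous_compact hg
  have e : g ω - ∫ ω', g ω' ∂μ = ∫ ω', (g ω - g ω') ∂μ := by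
    rw [integral_sub (integrable_const _) i1, integral_const]; simp
  rw [e, ← Real.norm_eq_abs]
  have := norm_integral_le_of_norm_le_const (μ := μ) (f := fun ω' => g ω - g ω') (C := h)
    (ae_of_all _ fun ω' => by simpa [Real.norm_eq_abs] using hosc ω ω')
  simpa using this

omit [IsProbabilityMeasure μ] in
/-- **Two states average a function of oscillation `≤ ω` to within `ω`.**  Probability measures `μ` on `Ω` and
`ν` on `Ω'`, continuous `g : Ω → ℝ`, `g' : Ω' → ℝ` with `|g u − g' v| ≤ ω` for all `u, v`:
`|∫ g dμ − ∫ g' dν| ≤ ω`. [folklore] -/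
theorem abs_integral_sub_integral_le_of_osc [IsProbabilityMeasure μ] {Ω' : Type*} [TopologicalSpace Ω']
    [CompactSpace Ω'] [MeasurableSpace Ω'] [OpensMeasurableSpace Ω'] {ν : Measure Ω'} [IsProbabilityMeasure ν]
    {g : Ω → ℝ} {g' : Ω' → ℝ} (hg : Continuous g) (hg' : Continuous g') {ω : ℝ}
    (hosc : ∀ u v, |g u - g' v| ≤ ω) : |∫ u, g u ∂μ - ∫ v, g' v ∂ν| ≤ ω := by
  have i1 : Integrable g μ := integrable_of_continuous_compact hg
  have i2 : Integrable g' ν := integrable_of_continuous_compact hg'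
  -- `∫ g dμ` is within `ω` of every value `g' v`
  have step : ∀ v, |(∫ u, g u ∂μ) - g' v| ≤ ω := fun v => by
    have e : (∫ u, g u ∂μ) - g' v = ∫ u, (g u - g' v) ∂μ := by
      rw [integral_sub i1 (integrable_const _), integral_const]; simp
    rw [e, ← Real.norm_eq_abs]
    have := norm_integral_le_of_norm_le_const (μ := μ) (f := fun u => g u - g' v) (C := ω)
      (ae_of_all _ fun u => by simpa [Real.norm_eq_abs] using hosc u v)
    simpa using this
  have e : (∫ u, g u ∂μ) - ∫ v, g' v ∂ν = ∫ v, ((∫ u, g u ∂μ) - g' v) ∂ν := by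
    rw [integral_sub (integrable_const _) i2, integral_const]; simp
  rw [e, ← Real.norm_eq_abs]
  have := norm_integral_le_of_norm_le_const (μ := ν) (f := fun v => (∫ u, g u ∂μ) - g' v) (C := ω)
    (ae_of_all _ fun v => by simpa [Real.norm_eq_abs] using step v)
  simpa using this

/-- **Law of total covariance, two-sided, oscillation form.**  With (continuous) conditional expectations
`gAB, gA, gB` of `AB, A, B` given the exterior whose values oscillate by at most `h`, `h'` (`|gA ω − gA ω'| ≤ h`,
`|gB ω − gB ω'| ≤ h'`), the total covariance `∫ gAB − (∫ gA)(∫ gB)` is within `h h'` of the mean conditional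
covariance `∫ (gAB − gA gB)` (the difference is the covariance of the conditional means). [folklore] -/
theorem abs_cov_sub_integral_condCov_le_of_osc {gA gB gAB : Ω → ℝ} (hA : Continuous gA) (hB : Continuous gB)
    (hAB : Continuous gAB) {h h' : ℝ} (hoA : ∀ ω ω', |gA ω - gA ω'| ≤ h) (hoB : ∀ ω ω', |gB ω - gB ω'| ≤ h') :
    |(∫ ω, gAB ω ∂μ - (∫ ω, gA ω ∂μ) * (∫ ω, gB ω ∂μ)) - ∫ ω, (gAB ω - gA ω * gB ω) ∂μ| ≤ h * h' := by
  set mA := ∫ ω, gA ω ∂μ with hmA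
  set mB := ∫ ω, gB ω ∂μ with hmB
  have hdevA : ∀ ω, |gA ω - mA| ≤ h := abs_sub_integral_le_of_osc hA hoA
  have hdevB : ∀ ω, |gB ω - mB| ≤ h' := abs_sub_integral_le_of_osc hB hoB
  have iA : Integrable gA μ := integrable_of_continuous_compact hA
  have iB : Integrable gB μ := integrable_of_continuous_compact hB
  have iAB : Integrable gAB μ := integrable_of_continuous_compact hAB
  have iAgB : Integrable (fun ω => gA ω * gB ω) μ := integrable_of_continuous_compact (hA.mul hB)
  have hsplit : (∫ ω, gAB ω ∂μ - mA * mB) - ∫ ω, (gAB ω - gA ω * gB ω) ∂μ =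
      ∫ ω, (gA ω - mA) * (gB ω - mB) ∂μ := by
    have e : (fun ω => (gA ω - mA) * (gB ω - mB)) =
        fun ω => (gA ω * gB ω - mA * gB ω - mB * gA ω) + mA * mB := by
      funext ω; ring
    have i1 : Integrable (fun ω => gA ω * gB ω - mA * gB ω) μ := iAgB.sub (iB.const_mul mA)
    have i2 : Integrable (fun ω => gA ω * gB ω - mA * gB ω - mB * gA ω) μ := i1.sub (iA.const_mul mB)
    rw [e, integral_add i2 (integrable_const _), integral_sub i1 (iA.const_mul mB),
      integral_sub iAgB (iB.const_mul mA), integral_const_mul, integral_const_mul, integral_const,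
      integral_sub iAB iAgB]
    simp only [probReal_univ, smul_eq_mul, one_mul]
    ring
  rw [hsplit, ← Real.norm_eq_abs]
  have hpt : ∀ ω, ‖(gA ω - mA) * (gB ω - mB)‖ ≤ h * h' := fun ω => by
    rw [Real.norm_eq_abs, abs_mul]
    exact mul_le_mul (hdevA ω) (hdevB ω) (abs_nonneg _) ((abs_nonneg _).trans (hdevA ω))
  have := norm_integral_le_of_norm_le_const (μ := μ) (ae_of_all _ hpt)
  simpa using this

/-- **Law of total cumulance (third order), two-sided, oscillation form.**  Conditional expectations
`F₁, F₂, F₃, F₁₂, F₁₃, F₂₃, F₁₂₃` of `A, B, C, AB, AC, BC, ABC` given the exterior (continuous in the exterior), whose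
one-point values oscillate by at most `k₁, k₂, k₃` and whose conditional covariances `F_{jk} − F_j F_k` oscillate by
at most `w_{jk}`.  Then the total third cumulant `∫F₁₂₃ − m₁∫F₂₃ − m₂∫F₁₃ − m₃∫F₁₂ + 2 m₁m₂m₃` (`mᵢ = ∫Fᵢ`) is within
`k₁ w₂₃ + k₂ w₁₃ + k₃ w₁₂ + k₁ k₂ k₃` of the mean conditional third cumulant
`∫ (F₁₂₃ − F₁F₂₃ − F₂F₁₃ − F₃F₁₂ + 2F₁F₂F₃)`: indeed `κ₃ = ∫κ₃(·|ext) + Σᵢ ∫(Fᵢ − mᵢ)(C_{jk} − c_{jk}) + ∫∏(Fᵢ − mᵢ)`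
(Brillinger 1969; the terms linear in `Fᵢ − mᵢ` with constant coefficients integrate to zero). [folklore] -/
theorem abs_cum3_sub_integral_condCum3_le_of_osc {F₁ F₂ F₃ F₁₂ F₁₃ F₂₃ F₁₂₃ : Ω → ℝ}
    (h₁ : Continuous F₁) (h₂ : Continuous F₂) (h₃ : Continuous F₃) (h₁₂ : Continuous F₁₂)
    (h₁₃ : Continuous F₁₃) (h₂₃ : Continuous F₂₃) (h₁₂₃ : Continuous F₁₂₃)
    {k₁ k₂ k₃ w₁₂ w₁₃ w₂₃ : ℝ}
    (ho₁ : ∀ ω ω', |F₁ ω - F₁ ω'| ≤ k₁) (ho₂ : ∀ ω ω', |F₂ ω - F₂ ω'| ≤ k₂)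
    (ho₃ : ∀ ω ω', |F₃ ω - F₃ ω'| ≤ k₃)
    (hw₂₃ : ∀ ω ω', |(F₂₃ ω - F₂ ω * F₃ ω) - (F₂₃ ω' - F₂ ω' * F₃ ω')| ≤ w₂₃)
    (hw₁₃ : ∀ ω ω', |(F₁₃ ω - F₁ ω * F₃ ω) - (F₁₃ ω' - F₁ ω' * F₃ ω')| ≤ w₁₃)
    (hw₁₂ : ∀ ω ω', |(F₁₂ ω - F₁ ω * F₂ ω) - (F₁₂ ω' - F₁ ω' * F₂ ω')| ≤ w₁₂) :
    |((∫ ω, F₁₂₃ ω ∂μ) - (∫ ω, F₁ ω ∂μ) * (∫ ω, F₂₃ ω ∂μ) - (∫ ω, F₂ ω ∂μ) * (∫ ω, F₁₃ ω ∂μ)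
        - (∫ ω, F₃ ω ∂μ) * (∫ ω, F₁₂ ω ∂μ) + 2 * ((∫ ω, F₁ ω ∂μ) * (∫ ω, F₂ ω ∂μ) * (∫ ω, F₃ ω ∂μ)))
      - ∫ ω, (F₁₂₃ ω - F₁ ω * F₂₃ ω - F₂ ω * F₁₃ ω - F₃ ω * F₁₂ ω + 2 * (F₁ ω * F₂ ω * F₃ ω)) ∂μ|
      ≤ k₁ * w₂₃ + k₂ * w₁₃ + k₃ * w₁₂ + k₁ * k₂ * k₃ := by
  set m₁ := ∫ ω, F₁ ω ∂μ with hm₁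
  set m₂ := ∫ ω, F₂ ω ∂μ with hm₂
  set m₃ := ∫ ω, F₃ ω ∂μ with hm₃
  set c₂₃ := ∫ ω, (F₂₃ ω - F₂ ω * F₃ ω) ∂μ with hc₂₃
  set c₁₃ := ∫ ω, (F₁₃ ω - F₁ ω * F₃ ω) ∂μ with hc₁₃
  set c₁₂ := ∫ ω, (F₁₂ ω - F₁ ω * F₂ ω) ∂μ with hc₁₂
  have I : ∀ {f : Ω → ℝ}, Continuous f → Integrable f μ := fun hf => integrable_of_continuous_compact hf
  have hd₁ : ∀ ω, |F₁ ω - m₁| ≤ k₁ := abs_sub_integral_le_of_osc h₁ ho₁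
  have hd₂ : ∀ ω, |F₂ ω - m₂| ≤ k₂ := abs_sub_integral_le_of_osc h₂ ho₂
  have hd₃ : ∀ ω, |F₃ ω - m₃| ≤ k₃ := abs_sub_integral_le_of_osc h₃ ho₃
  have hC₂₃c : Continuous fun ω => F₂₃ ω - F₂ ω * F₃ ω := h₂₃.sub (h₂.mul h₃)
  have hC₁₃c : Continuous fun ω => F₁₃ ω - F₁ ω * F₃ ω := h₁₃.sub (h₁.mul h₃)
  have hC₁₂c : Continuous fun ω => F₁₂ ω - F₁ ω * F₂ ω := h₁₂.sub (h₁.mul h₂)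
  have hdC₂₃ : ∀ ω, |(F₂₃ ω - F₂ ω * F₃ ω) - c₂₃| ≤ w₂₃ := abs_sub_integral_le_of_osc hC₂₃c hw₂₃
  have hdC₁₃ : ∀ ω, |(F₁₃ ω - F₁ ω * F₃ ω) - c₁₃| ≤ w₁₃ := abs_sub_integral_le_of_osc hC₁₃c hw₁₃
  have hdC₁₂ : ∀ ω, |(F₁₂ ω - F₁ ω * F₂ ω) - c₁₂| ≤ w₁₂ := abs_sub_integral_le_of_osc hC₁₂c hw₁₂
  have hz : ∀ {F : Ω → ℝ}, Continuous F → ∫ ω, (F ω - ∫ ω', F ω' ∂μ) ∂μ = 0 := by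
    intro F hF
    rw [integral_sub (I hF) (integrable_const _), integral_const]
    simp
  -- the scalar third cumulant as one integral
  have iT₁ : Integrable (fun ω => F₁₂₃ ω - m₁ * F₂₃ ω) μ := (I h₁₂₃).sub ((I h₂₃).const_mul m₁)
  have iT₂ : Integrable (fun ω => F₁₂₃ ω - m₁ * F₂₃ ω - m₂ * F₁₃ ω) μ := iT₁.sub ((I h₁₃).const_mul m₂)
  have iT : Integrable (fun ω => F₁₂₃ ω - m₁ * F₂₃ ω - m₂ * F₁₃ ω - m₃ * F₁₂ ω) μ :=
    iT₂.sub ((I h₁₂).const_mul m₃)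
  have hlin : (∫ ω, F₁₂₃ ω ∂μ) - m₁ * (∫ ω, F₂₃ ω ∂μ) - m₂ * (∫ ω, F₁₃ ω ∂μ)
      - m₃ * (∫ ω, F₁₂ ω ∂μ) + 2 * (m₁ * m₂ * m₃) =
      ∫ ω, (F₁₂₃ ω - m₁ * F₂₃ ω - m₂ * F₁₃ ω - m₃ * F₁₂ ω + 2 * (m₁ * m₂ * m₃)) ∂μ := by
    rw [integral_add iT (integrable_const _), integral_sub iT₂ ((I h₁₂).const_mul m₃),
      integral_sub iT₁ ((I h₁₃).const_mul m₂), integral_sub (I h₁₂₃) ((I h₂₃).const_mul m₁),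
      integral_const_mul, integral_const_mul, integral_const_mul, integral_const]
    simp only [probReal_univ, smul_eq_mul, one_mul]
  -- the fluctuation part `D` and the mean-zero part `R`
  set D : Ω → ℝ := fun ω => (F₁ ω - m₁) * ((F₂₃ ω - F₂ ω * F₃ ω) - c₂₃)
      + (F₂ ω - m₂) * ((F₁₃ ω - F₁ ω * F₃ ω) - c₁₃) + (F₃ ω - m₃) * ((F₁₂ ω - F₁ ω * F₂ ω) - c₁₂)
      + (F₁ ω - m₁) * (F₂ ω - m₂) * (F₃ ω - m₃) with hD
  set R : Ω → ℝ := fun ω => (c₂₃ - m₂ * m₃) * (F₁ ω - m₁) + (c₁₃ - m₁ * m₃) * (F₂ ω - m₂)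
      + (c₁₂ - m₁ * m₂) * (F₃ ω - m₃) with hR
  have hDc : Continuous D := by simp only [hD]; fun_prop
  have hRc : Continuous R := by simp only [hR]; fun_prop
  have hcondc : Continuous fun ω =>
      F₁₂₃ ω - F₁ ω * F₂₃ ω - F₂ ω * F₁₃ ω - F₃ ω * F₁₂ ω + 2 * (F₁ ω * F₂ ω * F₃ ω) := by fun_prop
  have hpt : (fun ω => (F₁₂₃ ω - m₁ * F₂₃ ω - m₂ * F₁₃ ω - m₃ * F₁₂ ω + 2 * (m₁ * m₂ * m₃))
      - (F₁₂₃ ω - F₁ ω * F₂₃ ω - F₂ ω * F₁₃ ω - F₃ ω * F₁₂ ω + 2 * (F₁ ω * F₂ ω * F₃ ω)))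
      = fun ω => D ω + R ω := by
    funext ω; simp only [hD, hR]; ring
  have hRz : ∫ ω, R ω ∂μ = 0 := by
    have j₁ : Integrable (fun ω => (c₂₃ - m₂ * m₃) * (F₁ ω - m₁)) μ :=
      (I (h₁.sub continuous_const)).const_mul _
    have j₂ : Integrable (fun ω => (c₁₃ - m₁ * m₃) * (F₂ ω - m₂)) μ :=
      (I (h₂.sub continuous_const)).const_mul _
    have j₃ : Integrable (fun ω => (c₁₂ - m₁ * m₂) * (F₃ ω - m₃)) μ :=
      (I (h₃.sub continuous_const)).const_mul _
    have j₁₂ : Integrable (fun ω => (c₂₃ - m₂ * m₃) * (F₁ ω - m₁) + (c₁₃ - m₁ * m₃) * (F₂ ω - m₂)) μ :=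
      j₁.add j₂
    simp only [hR]
    rw [integral_add j₁₂ j₃, integral_add j₁ j₂, integral_const_mul, integral_const_mul,
      integral_const_mul, hz h₁, hz h₂, hz h₃]
    ring
  have hdiff : ((∫ ω, F₁₂₃ ω ∂μ) - m₁ * (∫ ω, F₂₃ ω ∂μ) - m₂ * (∫ ω, F₁₃ ω ∂μ)
      - m₃ * (∫ ω, F₁₂ ω ∂μ) + 2 * (m₁ * m₂ * m₃))
      - ∫ ω, (F₁₂₃ ω - F₁ ω * F₂₃ ω - F₂ ω * F₁₃ ω - F₃ ω * F₁₂ ω + 2 * (F₁ ω * F₂ ω * F₃ ω)) ∂μ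
      = ∫ ω, D ω ∂μ := by
    have iT' : Integrable (fun ω => F₁₂₃ ω - m₁ * F₂₃ ω - m₂ * F₁₃ ω - m₃ * F₁₂ ω
        + 2 * (m₁ * m₂ * m₃)) μ := iT.add (integrable_const _)
    rw [hlin, ← integral_sub iT' (I hcondc)]
    rw [show (fun ω => (F₁₂₃ ω - m₁ * F₂₃ ω - m₂ * F₁₃ ω - m₃ * F₁₂ ω + 2 * (m₁ * m₂ * m₃))
      - (F₁₂₃ ω - F₁ ω * F₂₃ ω - F₂ ω * F₁₃ ω - F₃ ω * F₁₂ ω + 2 * (F₁ ω * F₂ ω * F₃ ω)))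
      = fun ω => D ω + R ω from hpt]
    rw [integral_add (I hDc) (I hRc), hRz, add_zero]
  rw [hdiff, ← Real.norm_eq_abs]
  have amul : ∀ {x y u w : ℝ}, |x| ≤ u → |y| ≤ w → |x * y| ≤ u * w := fun hx hy => by
    rw [abs_mul]; exact mul_le_mul hx hy (abs_nonneg _) ((abs_nonneg _).trans hx)
  have hDpt : ∀ ω, ‖D ω‖ ≤ k₁ * w₂₃ + k₂ * w₁₃ + k₃ * w₁₂ + k₁ * k₂ * k₃ := fun ω => by
    rw [Real.norm_eq_abs]
    have b₁ := amul (hd₁ ω) (hdC₂₃ ω)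
    have b₂ := amul (hd₂ ω) (hdC₁₃ ω)
    have b₃ := amul (hd₃ ω) (hdC₁₂ ω)
    have b₄ := amul (amul (hd₁ ω) (hd₂ ω)) (hd₃ ω)
    have t₁ := abs_add_le ((F₁ ω - m₁) * ((F₂₃ ω - F₂ ω * F₃ ω) - c₂₃)
      + (F₂ ω - m₂) * ((F₁₃ ω - F₁ ω * F₃ ω) - c₁₃) + (F₃ ω - m₃) * ((F₁₂ ω - F₁ ω * F₂ ω) - c₁₂))
      ((F₁ ω - m₁) * (F₂ ω - m₂) * (F₃ ω - m₃))
    have t₂ := abs_add_le ((F₁ ω - m₁) * ((F₂₃ ω - F₂ ω * F₃ ω) - c₂₃)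
      + (F₂ ω - m₂) * ((F₁₃ ω - F₁ ω * F₃ ω) - c₁₃)) ((F₃ ω - m₃) * ((F₁₂ ω - F₁ ω * F₂ ω) - c₁₂))
    have t₃ := abs_add_le ((F₁ ω - m₁) * ((F₂₃ ω - F₂ ω * F₃ ω) - c₂₃))
      ((F₂ ω - m₂) * ((F₁₃ ω - F₁ ω * F₃ ω) - c₁₃))
    simp only [hD]
    linarith
  have := norm_integral_le_of_norm_le_const (μ := μ) (ae_of_all _ hDpt)
  simpa using this

end Moments

/-! ## §2 Covariance transfer between DLR-consistent states (cube kernels, tori) -/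

section Kernel

variable (G : Type) [Group G] [TopologicalSpace G] [IsTopologicalGroup G] [CompactSpace G]
  [MeasurableSpace G] [BorelSpace G] (r : LatticeRep G)

/-- The cube-kernel mean of a bounded continuous observable is continuous in the exterior (Feller property of
the tree's `ymSpecification`, `continuous_integral_ymSpecification`). [folklore] -/
theorem continuous_kerE (β : ℝ) (c : Fin 4 → ℤ) (b : ℕ) {F : LGConfig 4 G → ℝ} (hF : Continuous F)
    {M : ℝ} (hM : ∀ U, |F U| ≤ M) : Continuous fun ζ => kerE G r β c b ζ F := by
  haveI := r.secondCountableTopology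
  unfold kerE
  exact continuous_integral_ymSpecification r.ρ r.continuous β _ hF hM

omit [TopologicalSpace G] [IsTopologicalGroup G] [CompactSpace G] [MeasurableSpace G] [BorelSpace G] in
/-- A product of two bounded functions is bounded by the product of the bounds. [folklore] -/
theorem abs_mul_le_of_abs_le {F G' : LGConfig 4 G → ℝ} {MF MG : ℝ} (hMF : ∀ U, |F U| ≤ MF)
    (hMG : ∀ U, |G' U| ≤ MG) (U : LGConfig 4 G) : |F U * G' U| ≤ MF * MG := by
  rw [abs_mul]
  exact mul_le_mul (hMF U) (hMG U) (abs_nonneg _) ((abs_nonneg _).trans (hMF (fun _ => 1)))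

/-- The cube-kernel covariance of two bounded continuous observables is continuous in the exterior. [folklore] -/
theorem continuous_kerCov (β : ℝ) (c : Fin 4 → ℤ) (b : ℕ) {F G' : LGConfig 4 G → ℝ} (hF : Continuous F)
    (hG : Continuous G') {MF MG : ℝ} (hMF : ∀ U, |F U| ≤ MF) (hMG : ∀ U, |G' U| ≤ MG) :
    Continuous fun ζ => kerCov G r β c b ζ F G' := by
  unfold kerCov
  exact (continuous_kerE G r β c b (hF.mul hG) (abs_mul_le_of_abs_le G hMF hMG)).sub
    ((continuous_kerE G r β c b hF hMF).mul (continuous_kerE G r β c b hG hMG))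

/-- **Reference kernel ↔ mean of sub-cube kernel covariances (two-sided, oscillation form).**  Nested cubes
`P = (c₀, b₀) ⊆ Q = (c, b)` (interior links), ONE exterior `η₀` of `Q`, bounded continuous `F, G'` whose `P`-kernel
means oscillate over exteriors by at most `h, h'`.  Then the `Q`-kernel covariance of `F, G'` is within `h h'` of the
`Q`-kernel mean of the `P`-kernel covariances: `|kerCov_Q^{η₀}(F,G') − kerE_Q^{η₀}[ζ ↦ kerCov_P^ζ(F,G')]| ≤ h h'`
(consistency `kerE_kerE_of_subset` ×3 + `abs_cov_sub_integral_condCov_le_of_osc`). [folklore] -/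
theorem abs_kerCov_sub_kerE_kerCov_le (β : ℝ) {c c₀ : Fin 4 → ℤ} {b b₀ : ℕ}
    (hsub : cubeEdges c₀ b₀ ⊆ cubeEdges c b) (η₀ : LGConfig 4 G) {F G' : LGConfig 4 G → ℝ}
    (hFc : Continuous F) (hGc : Continuous G') {MF MG : ℝ} (hMF : ∀ U, |F U| ≤ MF) (hMG : ∀ U, |G' U| ≤ MG)
    {h h' : ℝ} (hoF : ∀ ζ ζ', |kerE G r β c₀ b₀ ζ F - kerE G r β c₀ b₀ ζ' F| ≤ h)
    (hoG : ∀ ζ ζ', |kerE G r β c₀ b₀ ζ G' - kerE G r β c₀ b₀ ζ' G'| ≤ h') :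
    |kerCov G r β c b η₀ F G' - kerE G r β c b η₀ (fun ζ => kerCov G r β c₀ b₀ ζ F G')| ≤ h * h' := by
  haveI := r.secondCountableTopology
  haveI := isProbabilityMeasure_ymSpecification r.ρ r.continuous β (cubeEdges c b) η₀
  have hFG : Continuous fun U => F U * G' U := hFc.mul hGc
  have hFGb : ∀ U, |F U * G' U| ≤ MF * MG := abs_mul_le_of_abs_le G hMF hMG
  have hfc := continuous_kerE G r β c₀ b₀ hFc hMF
  have hgc := continuous_kerE G r β c₀ b₀ hGc hMG
  have hfgc := continuous_kerE G r β c₀ b₀ hFG hFGb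
  have hEFG : kerE G r β c b η₀ (fun U => F U * G' U) =
      kerE G r β c b η₀ (fun ζ => kerE G r β c₀ b₀ ζ (fun U => F U * G' U)) :=
    (kerE_kerE_of_subset G r β hsub η₀ hFG.measurable hFGb).symm
  have hEF : kerE G r β c b η₀ F = kerE G r β c b η₀ (fun ζ => kerE G r β c₀ b₀ ζ F) :=
    (kerE_kerE_of_subset G r β hsub η₀ hFc.measurable hMF).symm
  have hEG : kerE G r β c b η₀ G' = kerE G r β c b η₀ (fun ζ => kerE G r β c₀ b₀ ζ G') :=
    (kerE_kerE_of_subset G r β hsub η₀ hGc.measurable hMG).symm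
  have key := abs_cov_sub_integral_condCov_le_of_osc
    (μ := ymSpecification (d := 4) r.ρ β (cubeEdges c b) η₀)
    (gA := fun ζ => kerE G r β c₀ b₀ ζ F) (gB := fun ζ => kerE G r β c₀ b₀ ζ G')
    (gAB := fun ζ => kerE G r β c₀ b₀ ζ (fun U => F U * G' U)) hfc hgc hfgc hoF hoG
  unfold kerCov
  rw [hEFG, hEF, hEG]
  simp only [kerE] at key ⊢
  exact key

/-- The one-cube torus DLR step `∫ F∘lift dμ_T = ∫ (kerE_P F)∘lift dμ_T`, continuity of the lifted kernel mean —
packaged for a cube `P = (c₀, b₀)` inside the torus of side `2L+1 ≥ b₀ + 3`. [folklore] -/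
theorem continuous_kerE_torusLift (β : ℝ) (c₀ : Fin 4 → ℤ) (b₀ T : ℕ) {F : LGConfig 4 G → ℝ}
    (hF : Continuous F) {M : ℝ} (hM : ∀ U, |F U| ≤ M) :
    Continuous fun U : GaugeConfig 4 T G => kerE G r β c₀ b₀ (torusLift T U) F :=
  (continuous_kerE G r β c₀ b₀ hF hM).comp (continuous_torusLift _)

/-- **Torus ↔ mean of cube-kernel covariances (two-sided, oscillation form).**  A cube `P = (c₀, b₀)`, a torus
of side `2L+1 ≥ b₀ + 3`, bounded continuous CYLINDER observables `F, G'` windowed in `P` whose `P`-kernel means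
oscillate over exteriors by at most `h, h'`.  Then the torus covariance of `F, G'` (read through the periodic lift)
is within `h h'` of the torus mean of the `P`-kernel covariances (`integral_lift_eq_integral_kerE_cube` ×3 +
`abs_cov_sub_integral_condCov_le_of_osc`). [folklore] -/
theorem abs_torusCov_sub_torusE_kerCov_le (β : ℝ) (c₀ : Fin 4 → ℤ) (b₀ L : ℕ) (hL : b₀ + 3 ≤ 2 * L + 1)
    {F G' : LGConfig 4 G → ℝ} (hFc : Continuous F) (hGc : Continuous G') {MF MG : ℝ}
    (hMF : ∀ U, |F U| ≤ MF) (hMG : ∀ U, |G' U| ≤ MG)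
    {SF SG : Finset (Literature.MathematicalPhysics.QuantumLattice.ZdEdge 4)}
    (hFS : IsCylinder F SF) (hGS : IsCylinder G' SG)
    (hSF : ∀ e ∈ SF, ∀ j, c₀ j ≤ e.1 j ∧ e.1 j ≤ c₀ j + b₀)
    (hSG : ∀ e ∈ SG, ∀ j, c₀ j ≤ e.1 j ∧ e.1 j ≤ c₀ j + b₀) {h h' : ℝ}
    (hoF : ∀ ζ ζ', |kerE G r β c₀ b₀ ζ F - kerE G r β c₀ b₀ ζ' F| ≤ h)
    (hoG : ∀ ζ ζ', |kerE G r β c₀ b₀ ζ G' - kerE G r β c₀ b₀ ζ' G'| ≤ h') :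
    |(torusE G r β L (fun U => F U * G' U) - torusE G r β L F * torusE G r β L G')
      - torusE G r β L (fun ζ => kerCov G r β c₀ b₀ ζ F G')| ≤ h * h' := by
  classical
  haveI := r.secondCountableTopology
  haveI := isProbabilityMeasure_wilsonMeasure (d := 4) (L := 2 * L + 1) r.ρ r.continuous β
  have hFG : Continuous fun U => F U * G' U := hFc.mul hGc
  have hFGb : ∀ U, |F U * G' U| ≤ MF * MG := abs_mul_le_of_abs_le G hMF hMG
  have e1 := integral_lift_eq_integral_kerE_cube G r β c₀ b₀ (2 * L + 1) hL hFc hMF hFS hSF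
  have e2 := integral_lift_eq_integral_kerE_cube G r β c₀ b₀ (2 * L + 1) hL hGc hMG hGS hSG
  have e3 := integral_lift_eq_integral_kerE_cube G r β c₀ b₀ (2 * L + 1) hL hFG hFGb (isCylinder_mul hFS hGS)
    (fun e he j => by
      rcases Finset.mem_union.1 he with h₁ | h₂
      · exact hSF e h₁ j
      · exact hSG e h₂ j)
  have key := abs_cov_sub_integral_condCov_le_of_osc (μ := wilsonMeasure (d := 4) (L := 2 * L + 1) r.ρ β)
    (continuous_kerE_torusLift G r β c₀ b₀ (2 * L + 1) hFc hMF)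
    (continuous_kerE_torusLift G r β c₀ b₀ (2 * L + 1) hGc hMG)
    (continuous_kerE_torusLift G r β c₀ b₀ (2 * L + 1) hFG hFGb)
    (fun U V => hoF _ _) (fun U V => hoG _ _)
  simp only [torusE]
  rw [e1, e2, e3]
  simp only [kerCov] at key ⊢
  exact key

/-- **D3, two-sided — the REFERENCE-STATE TRANSFER for covariances.**  Nested cubes `P ⊆ Q`, ONE exterior `η₀`
of `Q` (the reference state `γ_Q(· | η₀)`), a torus of ANY side `2L+1 ≥ b₀ + 3`, bounded continuous cylinder
observables `F, G'` windowed in `P`; if the `P`-kernel means of `F, G'` oscillate over exteriors by `≤ h, h'` and the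
`P`-kernel covariance by `≤ ω`, then `|torusCov_L(F,G') − kerCov_Q^{η₀}(F,G')| ≤ 2 h h' + ω` — uniformly in `L`.
The exteriors of `P` and the torus size enter only through the sign-free oscillations `h, h', ω`. [folklore] -/
theorem abs_torusCov_sub_kerCov_le (β : ℝ) {c c₀ : Fin 4 → ℤ} {b b₀ : ℕ}
    (hsub : cubeEdges c₀ b₀ ⊆ cubeEdges c b) (η₀ : LGConfig 4 G) (L : ℕ) (hL : b₀ + 3 ≤ 2 * L + 1)
    {F G' : LGConfig 4 G → ℝ} (hFc : Continuous F) (hGc : Continuous G') {MF MG : ℝ}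
    (hMF : ∀ U, |F U| ≤ MF) (hMG : ∀ U, |G' U| ≤ MG)
    {SF SG : Finset (Literature.MathematicalPhysics.QuantumLattice.ZdEdge 4)}
    (hFS : IsCylinder F SF) (hGS : IsCylinder G' SG)
    (hSF : ∀ e ∈ SF, ∀ j, c₀ j ≤ e.1 j ∧ e.1 j ≤ c₀ j + b₀)
    (hSG : ∀ e ∈ SG, ∀ j, c₀ j ≤ e.1 j ∧ e.1 j ≤ c₀ j + b₀) {h h' ω : ℝ}
    (hoF : ∀ ζ ζ', |kerE G r β c₀ b₀ ζ F - kerE G r β c₀ b₀ ζ' F| ≤ h)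
    (hoG : ∀ ζ ζ', |kerE G r β c₀ b₀ ζ G' - kerE G r β c₀ b₀ ζ' G'| ≤ h')
    (hoC : ∀ ζ ζ', |kerCov G r β c₀ b₀ ζ F G' - kerCov G r β c₀ b₀ ζ' F G'| ≤ ω) :
    |(torusE G r β L (fun U => F U * G' U) - torusE G r β L F * torusE G r β L G')
      - kerCov G r β c b η₀ F G'| ≤ 2 * h * h' + ω := by
  haveI := r.secondCountableTopology
  haveI := isProbabilityMeasure_wilsonMeasure (d := 4) (L := 2 * L + 1) r.ρ r.continuous β
  haveI := isProbabilityMeasure_ymSpecification r.ρ r.continuous β (cubeEdges c b) η₀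
  have t1 := abs_torusCov_sub_torusE_kerCov_le G r β c₀ b₀ L hL hFc hGc hMF hMG hFS hGS hSF hSG hoF hoG
  have t2 := abs_kerCov_sub_kerE_kerCov_le G r β hsub η₀ hFc hGc hMF hMG hoF hoG
  have hcont := continuous_kerCov G r β c₀ b₀ hFc hGc hMF hMG
  have t3 : |torusE G r β L (fun ζ => kerCov G r β c₀ b₀ ζ F G') -
      kerE G r β c b η₀ (fun ζ => kerCov G r β c₀ b₀ ζ F G')| ≤ ω := by
    unfold torusE kerE
    exact abs_integral_sub_integral_le_of_osc (hcont.comp (continuous_torusLift _)) hcont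
      (fun U ζ => hoC _ _)
  have tri := abs_sub_le
    (torusE G r β L (fun U => F U * G' U) - torusE G r β L F * torusE G r β L G')
    (torusE G r β L (fun ζ => kerCov G r β c₀ b₀ ζ F G')) (kerCov G r β c b η₀ F G')
  have tri₂ := abs_sub_le (torusE G r β L (fun ζ => kerCov G r β c₀ b₀ ζ F G'))
    (kerE G r β c b η₀ (fun ζ => kerCov G r β c₀ b₀ ζ F G')) (kerCov G r β c b η₀ F G')
  rw [abs_sub_comm] at t2
  linarith

end Kernel

end Summit.QuantumFields.YangMills.Cruxes.NT.Reference

end
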